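import Summits.BirchSwinnertonDyer.BirchSwinnertonDyer.Theorems.KolyvaginDepthDoorDepthTableKuriharaDecisivePrime
import Summits.BirchSwinnertonDyer.BirchSwinnertonDyer.Theorems.KolyvaginDepthDoorDepthTableKuriharaSocket944e1
import Summits.BirchSwinnertonDyer.Rank1Residual.Supersingular.CountPointsFast
import HarnessLib

/-!
# Route `KolyvaginDepthDoor`, crux `KolyvaginDepthSupplyKN` (stmt-BirchSwinnertonDyer-22820) —
# DEPTH TABLE v20, ROW `944e1` @ `(5, d_K = -31)` (SPLIT CELL): THE DECISIVE PRIME `ℓ★ = 191` — the row's bit ⟺ a unit mod-`5`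
# Kurihara number of the twist model `T₀ = [0, 0, 0, -18259, -1012894]` AT THE ONE PRIME `191` (kernel: `38 • P̄ ≠ O` in `T̃₀(𝔽_191)`
# for the tree's twist point `P = (118081/225, 39060604/3375)`, `#T̃₀(𝔽_191) = 190 = 5·38`)

Helper file of the lead prover of line `levelone` (kdd-p1 g24; `--supports stmt-BirchSwinnertonDyer-22820
--as helper`); it closes nothing and BSD is NOT proved by it. Same template as `…KuriharaDecisive916c1` (split cell), with the
rational-point bridge of `…KuriharaDecisive681c1`.

v19 (g23, `…KuriharaSocket944e1`) gave this row its socket AND its exact depth-one reading (`kolyvaginPrime_iff_twistKuriharaBit_5_neg31`: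
bit ⟺ «SOME cyclic Kolyvagin prime of `(T₀, 5)` carries a unit `δ̃(T₀)`»), but no decisive prime — CLOSING-DATA-v19: «no rational
point of small height found on `T₀`» (integral search). The point is ALREADY IN THE TREE: the kernel twist point of the v12 table
(g16, `C944e1.one_le_rank_twist_neg31`: `(472324/225, 312484832/3375)` on the `u = 1/2` model `[0, 0, 0, -292144, -64825216]`)
transports to `P = (118081/225, 39060604/3375)` on the minimal model `T₀` (`x = X/4`, `y = Y/8`; denominators `15²`, `15³`). At the
least cyclic Kolyvagin prime `191` of `(T₀, 5)` (`#T̃₀(𝔽_191) = 190 = 5·38`, `a_191(T₀) = 2`; `191` is also the second prime of the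
E-side record `cert_944e1` @ `(5, 31·191)`) the reduction `P̄ = (108, 128)` has `38 • P̄ = (0, 19) ≠ O` (7-step chain, `decide`), so
`P ∉ 5·T₀(ℚ_191)` by `localNondivisible_of_chainB_rat`, and by the generic `…KuriharaDecisivePrime` (Sakamoto 2022 L4.4 + L4.6 (1) BY
NAME, `hSak3`) the bit — which gives `#Sel_5(E^{(-31)}) ≤ 5` by the exact reading — FORCES `δ̃_191(T₀) ≢ 0 (mod 5)`. HENCE

* `twistKuriharaBit_iff_unit_191` — **bit ⟺ unit `δ̃_191(T₀)`**: the fleet's ONE residue `δ̃_191(T₀) mod 5` DECIDES the row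
  `944e1` @ `(5, -31)` BOTH WAYS modulo print (a computed ZERO refutes the clause at `(5, ℚ(√-31))`, a UNIT proves it via the socket).
  `N_{T₀} = 907184`; cyclic Kolyvagin primes of `(T₀, 5)` below `1200`: `191, 521, 971, 1051, 1091, 1171` (all ★ for `P`).

Kernel lemmas: `minTwist31_card_191`, `minTwist31_isCyclicKolyvaginLevel_5_191`, `minTwist31_nonsingular_P`, `chain191_mult/_ok`,
`minTwist31_localNondivisible_191`. CONDITIONAL on the named facts displayed and the E-side record claim `hδE`; per curve; nothing
class-wide; BSD is NOT proved by any of this.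

References: [Sakamoto2022pSelmer] Lemma 4.4, Lemma 4.6 (1), Thm. 1.2, Thm. 1.5; [Kim2022StructureSelmer] Thm. 1.11;
[CastellaSano2026] Thm. 3; [Zanarella2019] Prop. 2.18; [Kurihara2014] §5.3; [SilvermanAEC2009] III.2.3, VII.2.1, VII.3.1;
[CremonaAlgorithms1997] Table 1 (944e1).
-/

set_option linter.dupNamespace false

noncomputable section

open scoped Classical NumberField

namespace Summit.BirchSwinnertonDyer.BirchSwinnertonDyer.Theorems.KolyvaginDepthDoor

open Literature.NumberTheory.EllipticCurves Literature.NumberTheory.EllipticCurves.ModularForms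
  WeierstrassCurve NumberField IsDedekindDomain
open Summit.BirchSwinnertonDyer.BirchSwinnertonDyer.Theorems
open Summit.BirchSwinnertonDyer.BirchSwinnertonDyer.Rank2Observatory
open Summit.BirchSwinnertonDyer.BirchSwinnertonDyer.Rank1Residual (IntModel.frobeniusTrace_eq)
open Summit.BirchSwinnertonDyer.Rank1Residual.Supersingular (natCard_point_eq_of_countPoints countPoints_eq_of_fast)
open Summit.BirchSwinnertonDyer.Rank1Residual.Additive (card_torsion_le_of_intModel_of_card
  isKolyvaginPrime_of_intModel_of_card)

namespace C944e1

/-- `#T̃₀(𝔽_191) = 190 = 5·38` for `T₀ = [0, 0, 0, -18259, -1012894]` (`191 ≡ 1 (mod 5)`, `a_191(T₀) = 2 ≡ 2 (mod 5)`, `5² ∤ 190`),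
kernel-decided (`countPointsFast`). [cite: Kim2022StructureSelmer, §1.2.2 (PDF p. 5)] -/
theorem minTwist31_card_191 :
    Nat.card (((⟨0, 0, 0, -18259, -1012894⟩ : WeierstrassCurve ℤ).map (Int.castRingHom (ZMod 191))).toAffine.Point) = 190 :=
  haveI : Fact (Nat.Prime 191) := ⟨by norm_num⟩
  natCard_point_eq_of_countPoints 0 0 0 (-18259) (-1012894) 191 (by norm_num) (by decide +kernel) (n := 190)
    (countPoints_eq_of_fast (by decide +kernel))

/-- **`191` is a CYCLIC KOLYVAGIN PRIME for `(T₀, 5)`** (`191 ∤ 5·N_{T₀}`, `191 ≡ 1`, `a_191(T₀) ≡ 2 (mod 5)`, `#T̃₀(𝔽_191)[5] ≤ 5`).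
[cite: Kim2022StructureSelmer, §1.2.2 (PDF p. 5)] -/
theorem minTwist31_isCyclicKolyvaginLevel_5_191 :
    haveI := minTwist31_isGloballyMinimal; haveI := Fact.mk (by norm_num : Nat.Prime 5);
    IsCyclicKolyvaginLevel ((⟨0, 0, 0, -18259, -1012894⟩ : WeierstrassCurve ℤ).map (Int.castRingHom ℚ)) 5 191 := by
  haveI := minTwist31_isElliptic
  haveI := minTwist31_isGloballyMinimal
  haveI := Fact.mk (by norm_num : Nat.Prime 5)
  haveI : Fact (Nat.Prime 191) := ⟨by norm_num⟩
  have hℓ : Kato.IsKolyvaginPrime ((⟨0, 0, 0, -18259, -1012894⟩ : WeierstrassCurve ℤ).map (Int.castRingHom ℚ)) 5 1 191 :=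
    isKolyvaginPrime_of_intModel_of_card minTwist31_intModel 5 1 191 (by norm_num) (by decide +kernel) (by decide)
      minTwist31_card_191 (by norm_num)
  refine ⟨⟨Nat.squarefree_iff_nodup_primeFactorsList (by norm_num) |>.mpr (by simp), fun ℓ hℓ' ↦ ?_⟩, fun ℓ hℓ' hdvd ↦ ?_⟩
  · rw [show (191 : ℕ).primeFactors = {191} from (Nat.Prime.primeFactors (by norm_num)), Finset.mem_singleton] at hℓ'
    exact hℓ' ▸ hℓ
  · obtain rfl := (Nat.prime_dvd_prime_iff_eq hℓ'.out (by norm_num)).mp hdvd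
    exact card_torsion_le_of_intModel_of_card minTwist31_intModel 5 191 minTwist31_card_191 (by norm_num)

/-- The rational point `P = (118081/225, 39060604/3375)` of `T₀ = [0, 0, 0, -18259, -1012894]` (denominators powers of primes `≠ 191`; on the curve). [folklore] -/
theorem minTwist31_nonsingular_P :
    ((⟨0, 0, 0, -18259, -1012894⟩ : WeierstrassCurve ℤ).map (Int.castRingHom ℚ)).toAffine.Nonsingular ((118081 : ℚ) / 225) ((39060604 : ℚ) / 3375) :=
  nonsingular_rat_of_eq_rat _ (by decide +kernel) (by norm_num)

/-- The double-and-add chain from `P̄` reaches the multiplier `38`. [folklore] -/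
theorem chain191_mult :
    chainMult 1 [(true, ((95 : ℤ) : ZMod 191), ((48 : ℤ) : ZMod 191)), (true, ((163 : ℤ) : ZMod 191), ((74 : ℤ) : ZMod 191)), (true, ((99 : ℤ) : ZMod 191), ((73 : ℤ) : ZMod 191)), (false, ((52 : ℤ) : ZMod 191), ((2 : ℤ) : ZMod 191)), (true, ((123 : ℤ) : ZMod 191), ((42 : ℤ) : ZMod 191)), (false, ((9 : ℤ) : ZMod 191), ((183 : ℤ) : ZMod 191)), (true, ((0 : ℤ) : ZMod 191), ((19 : ℤ) : ZMod 191))] = 38 := by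
  decide

/-- The double-and-add chain from `P̄ = (108, 128)` to `38 • P̄ = (0, 19)` in `T̃₀(𝔽_191)` CHECKS (tangent / chord
certificates, `decide`). [cite: SilvermanAEC2009, III.2.3] -/
theorem chain191_ok :
    chainB (⟨0, 0, 0, -18259, -1012894⟩ : WeierstrassCurve ℤ) 191 (((108 : ℤ)) : ZMod 191) (((128 : ℤ)) : ZMod 191)
      ((((108 : ℤ)) : ZMod 191), (((128 : ℤ)) : ZMod 191))
      [(true, ((95 : ℤ) : ZMod 191), ((48 : ℤ) : ZMod 191)), (true, ((163 : ℤ) : ZMod 191), ((74 : ℤ) : ZMod 191)), (true, ((99 : ℤ) : ZMod 191), ((73 : ℤ) : ZMod 191)), (false, ((52 : ℤ) : ZMod 191), ((2 : ℤ) : ZMod 191)), (true, ((123 : ℤ) : ZMod 191), ((42 : ℤ) : ZMod 191)), (false, ((9 : ℤ) : ZMod 191), ((183 : ℤ) : ZMod 191)), (true, ((0 : ℤ) : ZMod 191), ((19 : ℤ) : ZMod 191))] = true := by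
  decide +kernel

/-- **KERNEL: `P = (118081/225, 39060604/3375)` is not divisible by `5` in `T₀(ℚ_191)`** — the chain certifies `38 • P̄ ≠ O` in
`T̃₀(𝔽_191)` for the reduction `P̄ = (108, 128)`, `5·38 = #T̃₀(𝔽_191)`, and `localNondivisible_of_chainB_rat`.
[cite: SilvermanAEC2009, III.2.3, VII.2 Prop. 2.1, VII.3 Prop. 3.1] -/
theorem minTwist31_localNondivisible_191 :
    haveI : Fact (Nat.Prime 191) := ⟨by norm_num⟩;
    ∀ Q : (((⟨0, 0, 0, -18259, -1012894⟩ : WeierstrassCurve ℤ).map (Int.castRingHom ℚ)).baseChange ℚ_[191]).toAffine.Point,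
      5 • Q ≠ WeierstrassCurve.Affine.Point.map (W' := ((⟨0, 0, 0, -18259, -1012894⟩ : WeierstrassCurve ℤ).map (Int.castRingHom ℚ)).toAffine)
        (S := ℚ) (Algebra.ofId ℚ ℚ_[191]) (.some ((118081 : ℚ) / 225) ((39060604 : ℚ) / 3375) minTwist31_nonsingular_P) := by
  haveI : Fact (Nat.Prime 191) := ⟨by norm_num⟩
  have hq : ¬ ((191 : ℕ) : ℤ) ∣ (⟨0, 0, 0, -18259, -1012894⟩ : WeierstrassCurve ℤ).Δ := by decide +kernel
  have hx : ¬ (191 : ℕ) ∣ (((118081 : ℚ) / 225)).den := by decide +kernel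
  have hy : ¬ (191 : ℕ) ∣ (((39060604 : ℚ) / 3375)).den := by decide +kernel
  have hm : ((191 : ℕ) : ℤ) ∣ (((118081 : ℚ) / 225)).num - (108 : ℤ) * (((118081 : ℚ) / 225)).den := by decide +kernel
  have hm' : ((191 : ℕ) : ℤ) ∣ (((39060604 : ℚ) / 3375)).num - (128 : ℤ) * (((39060604 : ℚ) / 3375)).den := by decide +kernel
  have hpk : 5 * 38 = Nat.card (((⟨0, 0, 0, -18259, -1012894⟩ : WeierstrassCurve ℤ).map (Int.castRingHom (ZMod 191))).toAffine.Point) := by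
    rw [minTwist31_card_191]
  exact localNondivisible_of_chainB_rat (⟨0, 0, 0, -18259, -1012894⟩ : WeierstrassCurve ℤ) 191 hq minTwist31_nonsingular_P hx hy hm hm' hpk
    chain191_mult (by convert chain191_ok)


/-- **ROW `944e1` @ `(5, -31)`: THE DECISIVE PRIME `191` — bit ⟺ unit `δ̃_191(T₀)`.** For every imaginary quadratic `K`
with `d_K = -31`, granted the named facts displayed and the E-side record claim `hδE`: «some frame, some Kolyvagin PRIME
`ℓ`, some Kolyvagin–Heegner datum of conductor `ℓ` with `c_1(ℓ) ≠ 0`» (the depth-table bit) holds IF AND ONLY IF «every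
datum `D` of `T₀` at level `N_{T₀}` with `5 ∤ c_D` and the period transfer has a UNIT mod-`5` Kurihara number AT `191`» —
the claim of a future tree record `cert_<T₀>` @ `(5, 191)`. (⟹): bit ⟹ `#Sel_5(E^{(-31)}) ≤ 5` (the socket's exact reading
∘ v18's twist IFF) ⟹ unit at `191` (`twistKuriharaClaim_prime_of_natCard_selmerGroup_le` with the kernel certificate
`minTwist31_localNondivisible_191`); (⟸): the exact reading with `m = 191` (`minTwist31_isCyclicKolyvaginLevel_5_191`, `ν(191) = 1`).
CONDITIONAL on the named facts and the claim; per curve; BSD is not proved by it.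
[cite: Sakamoto2022pSelmer, Lemma 4.4, Lemma 4.6 (1), Thm. 1.2, Thm. 1.5] [cite: Kim2022StructureSelmer, Thm. 1.11]
[cite: CremonaAlgorithms1997, Table 1 (944e1)] -/
theorem twistKuriharaBit_iff_unit_191
    (h372 : GrossLMS1991.prop37_2_frobeniusCongruence)
    (h3 : Literature.NumberTheory.EllipticCurves.CastellaSano2026_kolyvaginClass_selmerDivisibility_eq_padicValNat_tamagawaProduct)
    (hZ : Literature.NumberTheory.EllipticCurves.Zanarella2019_kolyvaginClass_one_ne_zero_of_not_selmerDivisible)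
    (hHZ : Literature.NumberTheory.EllipticCurves.HowardZanarella_exists_minimal_kolyvaginClass_one_selmerCard_of_ne_zero)
    (hKim : Kim2022_card_selmerGroup_le_pow_of_kuriharaNumber_ne_zero)
    (hSak1 : Sakamoto2022_card_selmerGroup_eq_pow_of_isDeltaMinimal)
    (hSak2 : Sakamoto2022_exists_cyclicLevel_kuriharaNumber_ne_zero)
    (hSak3 : Literature.NumberTheory.EllipticCurves.Sakamoto2022_kuriharaNumber_prime_ne_zero_of_localNondivisible)
    (hnf : exists_isNewformOf) (hMaz : mazur_not_dvd_maninConstant_of_odd)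
    (K : Type) [Field K] [NumberField K] (hK : IsImaginaryQuadratic K) (hD : NumberField.discr K = -31)
    (hδE : haveI := isElliptic_c944e1; haveI := isGloballyMinimal_c944e1;
      haveI : NeZero (((⟨0, 0, 0, -19, 34⟩ : WeierstrassCurve ℤ).map (Int.castRingHom ℚ)).conductorNorm ℤ) := neZero_conductorNorm_of_isElliptic _;
      haveI := Fact.mk (by norm_num : Nat.Prime 5);
      ∀ (D : ModularParametrizationData ((⟨0, 0, 0, -19, 34⟩ : WeierstrassCurve ℤ).map (Int.castRingHom ℚ)) (((⟨0, 0, 0, -19, 34⟩ : WeierstrassCurve ℤ).map (Int.castRingHom ℚ)).conductorNorm ℤ)), ¬ ((5 : ℕ) : ℤ) ∣ D.maninConstant →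
        (∃ u : ℚ, ‖(u : ℚ_[5])‖ = 1 ∧ ((⟨0, 0, 0, -19, 34⟩ : WeierstrassCurve ℤ).map (Int.castRingHom ℚ)).realPeriodRat = u * plusPeriod D.f) →
        ∃ ψ : (ℓ : ℕ) → (ZMod ℓ)ˣ →* Multiplicative (ZMod 5),
          (∀ ℓ ∈ (5921 : ℕ).primeFactors, Function.Surjective (ψ ℓ)) ∧ kuriharaNumber D.f 5 5921 ψ ≠ 0) :
    haveI := isElliptic_c944e1; haveI := isGloballyMinimal_c944e1;
    haveI : NeZero (((⟨0, 0, 0, -19, 34⟩ : WeierstrassCurve ℤ).map (Int.castRingHom ℚ)).conductorNorm ℤ) := neZero_conductorNorm_of_isElliptic _;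
    haveI := minTwist31_isElliptic; haveI := minTwist31_isGloballyMinimal;
    haveI : NeZero (((⟨0, 0, 0, -18259, -1012894⟩ : WeierstrassCurve ℤ).map (Int.castRingHom ℚ)).conductorNorm ℤ) := neZero_conductorNorm_of_isElliptic _;
    haveI := Fact.mk (by norm_num : Nat.Prime 5);
    (∃ (Dt : ModularParametrizationData ((⟨0, 0, 0, -19, 34⟩ : WeierstrassCurve ℤ).map (Int.castRingHom ℚ)) (((⟨0, 0, 0, -19, 34⟩ : WeierstrassCurve ℤ).map (Int.castRingHom ℚ)).conductorNorm ℤ)) (β : ℤ)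
      (ι : K →+* ℂ) (ℓ : ℕ) (d : KolyvaginHeegnerData Dt β ι ℓ),
      ℓ.Prime ∧ Zhang2014.IsKolyvaginPrime (((⟨0, 0, 0, -19, 34⟩ : WeierstrassCurve ℤ).map (Int.castRingHom ℚ)).conductorNorm ℤ) ((⟨0, 0, 0, -19, 34⟩ : WeierstrassCurve ℤ).map (Int.castRingHom ℚ)) K 5 ℓ ∧
        d.kolyvaginClass (p := 5) (by norm_num) 1 ≠ 0) ↔
    (∀ (D : ModularParametrizationData ((⟨0, 0, 0, -18259, -1012894⟩ : WeierstrassCurve ℤ).map (Int.castRingHom ℚ))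
          (((⟨0, 0, 0, -18259, -1012894⟩ : WeierstrassCurve ℤ).map (Int.castRingHom ℚ)).conductorNorm ℤ)),
        ¬ ((5 : ℕ) : ℤ) ∣ D.maninConstant →
        (∃ u : ℚ, ‖(u : ℚ_[5])‖ = 1 ∧
          ((⟨0, 0, 0, -18259, -1012894⟩ : WeierstrassCurve ℤ).map (Int.castRingHom ℚ)).realPeriodRat = u * plusPeriod D.f) →
        ∃ ψ : (q : ℕ) → (ZMod q)ˣ →* Multiplicative (ZMod 5),
          (∀ q ∈ (191 : ℕ).primeFactors, Function.Surjective (ψ q)) ∧ kuriharaNumber D.f 5 191 ψ ≠ 0) := by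
  haveI := isElliptic_c944e1
  haveI := isGloballyMinimal_c944e1
  haveI iNZ : NeZero (((⟨0, 0, 0, -19, 34⟩ : WeierstrassCurve ℤ).map (Int.castRingHom ℚ)).conductorNorm ℤ) :=
    neZero_conductorNorm_of_isElliptic _
  haveI := minTwist31_isElliptic
  haveI := minTwist31_isGloballyMinimal
  haveI iNZT : NeZero (((⟨0, 0, 0, -18259, -1012894⟩ : WeierstrassCurve ℤ).map (Int.castRingHom ℚ)).conductorNorm ℤ) :=
    neZero_conductorNorm_of_isElliptic _
  haveI iP := Fact.mk (by norm_num : Nat.Prime 5)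
  haveI : Fact (Nat.Prime 191) := ⟨by norm_num⟩
  haveI : NeZero (191 : ℕ) := ⟨by norm_num⟩
  have hsur : ((⟨0, 0, 0, -19, 34⟩ : WeierstrassCurve ℤ).map (Int.castRingHom ℚ)).HasSurjectiveModNGaloisRep ((5 : ℕ) : ℤ) := by
    simpa using hasSurjectiveModNGaloisRep_pow_5 1
  have hC : (⟨1, (0 : ℚ), (0 : ℚ), (0 : ℚ)⟩ : WeierstrassCurve.VariableChange ℚ) •
      ((⟨0, 0, 0, -18259, -1012894⟩ : WeierstrassCurve ℤ).map (Int.castRingHom ℚ)) =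
      ((⟨0, 0, 0, -19, 34⟩ : WeierstrassCurve ℤ).map (Int.castRingHom ℚ)).quadraticTwist ((NumberField.discr K : ℤ) : ℚ) := by
    rw [hD]; push_cast; exact minTwist31_smul_eq
  have hpD : ¬ (((5 : ℕ) : ℤ) ∣ NumberField.discr K) := by rw [hD]; decide
  have hiff := kolyvaginPrime_iff_twistKuriharaBit_5_neg31 h372 h3 hZ hHZ hKim hSak1 hSak2 hnf hMaz K hK hD hδE
  constructor
  · intro hbit D hc hu
    have hT := (natCard_selmerGroup_quadraticTwist_le_iff_kuriharaBit hKim hSak1 hSak2 hnf hMaz _ 5 le_rfl goodOrdinary_5.1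
      goodOrdinary_5.2 hsur (NumberField.discr_ne_zero K) hpD _ _ hC minTwist31_nonAnomalous_5 minTwist31_kodairaNeron_5 1).mpr (hiff.mp hbit)
    rw [pow_one] at hT
    exact twistKuriharaClaim_prime_of_natCard_selmerGroup_le hSak3 _ 5 le_rfl goodOrdinary_5.1 goodOrdinary_5.2 hsur
      (NumberField.discr_ne_zero K) hpD _ _ hC minTwist31_nonAnomalous_5 minTwist31_kodairaNeron_5 hT 191
      minTwist31_isCyclicKolyvaginLevel_5_191 _ minTwist31_localNondivisible_191 D hc hu
  · intro hunit
    refine hiff.mpr fun D hc hu ↦ ?_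
    obtain ⟨ψ, hψ, hne⟩ := hunit D hc hu
    refine ⟨191, inferInstance, minTwist31_isCyclicKolyvaginLevel_5_191, ?_, ψ, hψ, hne⟩
    rw [Nat.Prime.primeFactors (by norm_num), Finset.card_singleton]

end C944e1

end Summit.BirchSwinnertonDyer.BirchSwinnertonDyer.Theorems.KolyvaginDepthDoor

end
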